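import Summits.QuantumFields.YangMills.Theorems.AllWindowsColdBoxBoxMidWindowsSU22LineDefs
import Summits.QuantumFields.YangMills.Theorems.WeakCouplingRatesEventuallyPow
import HarnessLib

/-!
# LINE-17 «hypercontractive second-order tilt expansion» on crux `AllWindowsColdBox.BoxMidWindowsSU22` (stmt-QuantumFields-24003):
# the exponent window of stub G at `ε = 17θ/8`, `R = β^θ`

Helper for the registered stub G `stub_coreBound` of the critic-PASSed LINE-17 (skeleton v3, sha16 `4747b363e792659d`).  The tree's
one-scale windows (`eventually_oneScale_boundsG`, `eventually_hwin`) are hard-wired to the small-field exponent `ε = 3θ` and `θ ≤ 1/100`;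
LINE-17 runs at `ε = epsOf θ = 17θ/8` up to `θ = 1/16`, where the Gaussian tail must be taken at the FREE radius `R = β^θ` (not at the
link radius).  `eventually_lineWindow` packages, eventually in `β`, the six elementary facts the assembly needs: `1 ≤ β`; the Gaussian
link radius `√D·(12H²+2H+1)·β^θ/√β ≤ 2η`; the cubic Gaussian window `(D/2)β^{2θ}/β + 190·(√D(12H²+2H+1)β^θ/√β)³ < β^{2ε−1}`; the Gaussian
bad mass `240·D·(2H+1)⁴·e^{−β^{2θ}/2} < 1`; and the smallness facts `K·H⁶/β ≤ 1`, `96·β²·e^{−β^ε} ≤ 1/β` (`H = ⌈β^θ⌉`, `D = dimE ρ₂`,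
`η = etaOf β H ε`).  Everything is an instance of the generic eventual comparisons of `WeakCouplingRatesEventuallyPow`.

HONEST LABEL: a helper of ONE registered stub of one critic-PASSed line on the R2ξ″ RECORD-rung crux 24003; no crux, rung or summit is
proved here; the Yang–Mills mass gap is NOT proved by this file.
-/

set_option autoImplicit false

noncomputable section

open MeasureTheory ProbabilityTheory
open Literature.MathematicalPhysics.QuantumLattice
open Literature.MathematicalPhysics.QuantumFieldTheory
open Literature.MathematicalPhysics.QuantumFieldTheory.LatticeMaxwell
open Summit.QuantumFields.YangMills.Theorems.WeakCouplingRates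
open Summit.QuantumFields.YangMills.Theorems.ColdBoxAllGroups
open Summit.QuantumFields.YangMills.Theorems.FreeEnergyLogCoefficient

namespace Summit.QuantumFields.YangMills.Theorems.AllWindowsColdBoxBoxMidLine

open Filter Topology

/-- **The exponent window of LINE-17 at `ε = 17θ/8`, `R = β^θ`** (eventually in `β`, for `0 < θ ≤ 1/16`): `β ≥ 1`; the Gaussian link
radius `√D·(12H²+2H+1)·β^θ/√β` is below the conditioning radius `2η`; the cubic Gaussian window
`(D/2)β^{2θ}/β + 190·(√D(12H²+2H+1)β^θ/√β)³ < β^{2ε−1}`; the Gaussian bad mass `240·D·(2H+1)⁴e^{−β^{2θ}/2} < 1`; and the two smallness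
facts `K·H⁶/β ≤ 1`, `96·β²·e^{−β^ε} ≤ 1/β` (`H = ⌈β^θ⌉`, `D = dimE ρ₂`). -/
theorem eventually_lineWindow {θ : ℝ} (hθ : 0 < θ) (hθ16 : θ ≤ 1 / 16) (K : ℝ) :
    ∃ β₀ : ℝ, ∀ β : ℝ, β₀ ≤ β → 1 ≤ β ∧
      Real.sqrt (dimE ρ₂) * ((12 * (⌈β ^ θ⌉₊ : ℝ) ^ 2 + 2 * ⌈β ^ θ⌉₊ + 1) * β ^ θ) / Real.sqrt β ≤
        2 * etaOf β ⌈β ^ θ⌉₊ (epsOf θ) ∧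
      (dimE ρ₂ : ℝ) / 2 * (β ^ θ) ^ 2 / β +
          190 * (Real.sqrt (dimE ρ₂) * ((12 * (⌈β ^ θ⌉₊ : ℝ) ^ 2 + 2 * ⌈β ^ θ⌉₊ + 1) * β ^ θ) / Real.sqrt β) ^ 3 <
        β ^ (2 * epsOf θ - 1) ∧
      240 * (dimE ρ₂ : ℝ) * (2 * (⌈β ^ θ⌉₊ : ℝ) + 1) ^ 4 * Real.exp (-(β ^ θ) ^ 2 / 2) < 1 ∧
      K * (⌈β ^ θ⌉₊ : ℝ) ^ 6 / β ≤ 1 ∧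
      β ^ 2 * (24 * ((2 : ℕ) : ℝ) ^ 2 * Real.exp (-(β ^ epsOf θ))) ≤ 1 / β := by
  set D : ℕ := dimE ρ₂ with hD
  have hε : 0 < epsOf θ := by unfold epsOf; linarith
  have hθε : θ < epsOf θ := by unfold epsOf; linarith
  -- (1) `√D β^θ ≤ 2√2 β^ε`
  obtain ⟨b₁, hb₁1, h₁⟩ := exists_const_mul_rpow_le_rpow (Real.sqrt D / (2 * Real.sqrt 2)) hθε
  -- (2) `2D β^{2θ−1} ≤ β^{2ε−1}` and `2·190·D^{3/2}·27·(2H+3)^6 β^{3θ−3/2} ≤ β^{2ε−1}`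
  obtain ⟨b₂, hb₂1, h₂⟩ := exists_const_mul_rpow_le_rpow (2 * (D : ℝ)) (a := 2 * θ - 1) (b := 2 * epsOf θ - 1) (by linarith)
  obtain ⟨b₃, hb₃1, h₃⟩ := exists_const_mul_boxSide_pow_mul_rpow_le (2 * (190 * (Real.sqrt D) ^ 3 * 27)) 6
    (θ := θ) (a := 3 * θ - 3 / 2) (b := 2 * epsOf θ - 1) hθ (by unfold epsOf; push_cast; linarith)
  -- (3) bad mass: `2·240D(2H+3)^4 e^{−β^θ} ≤ 1`
  obtain ⟨b₄, hb₄1, h₄⟩ := exists_const_mul_boxSide_pow_mul_exp_neg_le (2 * (240 * (D : ℝ))) 4 hθ.le hθ (0 : ℝ)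
  -- (4) `64K β^{6θ−1} ≤ 1` and (5) `96 β² e^{−β^ε} ≤ β^{−1}`
  obtain ⟨b₅, hb₅1, h₅⟩ := exists_const_mul_rpow_le_rpow (64 * K) (a := 6 * θ - 1) (b := 0) (by linarith)
  obtain ⟨b₆, hb₆1, h₆⟩ := exists_const_mul_rpow_mul_exp_neg_le (24 * ((2 : ℕ) : ℝ) ^ 2) 2 (-1) hε
  -- `β^θ ≥ 2` eventually (for the bad mass)
  obtain ⟨b₇, hb₇1, h₇⟩ := exists_const_mul_rpow_le_rpow (2 : ℝ) (a := 0) (b := θ) hθ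
  refine ⟨max (max (max b₁ b₂) (max b₃ b₄)) (max (max b₅ b₆) b₇), fun β hβ => ?_⟩
  have hβ₁ : b₁ ≤ β := le_trans (le_trans (le_max_left _ _) (le_max_left _ _)) (le_trans (le_max_left _ _) hβ)
  have hβ₂ : b₂ ≤ β := le_trans (le_trans (le_max_right _ _) (le_max_left _ _)) (le_trans (le_max_left _ _) hβ)
  have hβ₃ : b₃ ≤ β := le_trans (le_trans (le_max_left _ _) (le_max_right _ _)) (le_trans (le_max_left _ _) hβ)
  have hβ₄ : b₄ ≤ β := le_trans (le_trans (le_max_right _ _) (le_max_right _ _)) (le_trans (le_max_left _ _) hβ)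
  have hβ₅ : b₅ ≤ β := le_trans (le_trans (le_max_left _ _) (le_max_left _ _)) (le_trans (le_max_right _ _) hβ)
  have hβ₆ : b₆ ≤ β := le_trans (le_trans (le_max_right _ _) (le_max_left _ _)) (le_trans (le_max_right _ _) hβ)
  have hβ₇ : b₇ ≤ β := le_trans (le_max_right _ _) (le_trans (le_max_right _ _) hβ)
  have hβ1 : 1 ≤ β := hb₁1.trans hβ₁
  have hβ0 : 0 < β := by linarith
  set H : ℕ := ⌈β ^ θ⌉₊ with hHdef
  have hHle : (H : ℝ) ≤ 2 * β ^ θ := (one_le_ceil_rpow_and_le hβ1 hθ.le).2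
  have hH1 : (1 : ℝ) ≤ H := (one_le_ceil_rpow_and_le hβ1 hθ.le).1
  have hP0 : 0 < 12 * (H : ℝ) ^ 2 + 2 * H + 1 := by positivity
  have hsq : Real.sqrt β = β ^ (1 / 2 : ℝ) := Real.sqrt_eq_rpow β
  have hsq2 : Real.sqrt (β ^ (2 * epsOf θ - 1)) = β ^ (epsOf θ - 1 / 2) := by
    rw [Real.sqrt_eq_rpow, ← Real.rpow_mul hβ0.le]; congr 1; ring
  refine ⟨hβ1, ?_, ?_, ?_, ?_, ?_⟩
  · -- link radius
    have key : Real.sqrt D * β ^ θ / Real.sqrt β ≤ 2 * (Real.sqrt 2 * Real.sqrt (β ^ (2 * epsOf θ - 1))) := by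
      have h := h₁ β hβ₁
      have hs2 : 0 < Real.sqrt 2 := Real.sqrt_pos.2 (by norm_num)
      rw [hsq2, hsq, div_le_iff₀ (Real.rpow_pos_of_pos hβ0 _)]
      have e : 2 * (Real.sqrt 2 * β ^ (epsOf θ - 1 / 2)) * β ^ (1 / 2 : ℝ) = 2 * Real.sqrt 2 * β ^ epsOf θ := by
        rw [show 2 * (Real.sqrt 2 * β ^ (epsOf θ - 1 / 2)) * β ^ (1 / 2 : ℝ) =
          2 * Real.sqrt 2 * (β ^ (epsOf θ - 1 / 2) * β ^ (1 / 2 : ℝ)) by ring, ← Real.rpow_add hβ0]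
        norm_num
      rw [e]
      have : Real.sqrt D / (2 * Real.sqrt 2) * β ^ θ * (2 * Real.sqrt 2) ≤ β ^ epsOf θ * (2 * Real.sqrt 2) :=
        mul_le_mul_of_nonneg_right h (by positivity)
      calc Real.sqrt D * β ^ θ = Real.sqrt D / (2 * Real.sqrt 2) * β ^ θ * (2 * Real.sqrt 2) := by field_simp
        _ ≤ β ^ epsOf θ * (2 * Real.sqrt 2) := this
        _ = 2 * Real.sqrt 2 * β ^ epsOf θ := by ring
    unfold etaOf
    have := mul_le_mul_of_nonneg_left key hP0.le
    calc Real.sqrt D * ((12 * (H : ℝ) ^ 2 + 2 * H + 1) * β ^ θ) / Real.sqrt β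
        = (12 * (H : ℝ) ^ 2 + 2 * H + 1) * (Real.sqrt D * β ^ θ / Real.sqrt β) := by ring
      _ ≤ (12 * (H : ℝ) ^ 2 + 2 * H + 1) * (2 * (Real.sqrt 2 * Real.sqrt (β ^ (2 * epsOf θ - 1)))) := this
      _ = 2 * ((12 * (H : ℝ) ^ 2 + 2 * H + 1) * (Real.sqrt 2 * Real.sqrt (β ^ (2 * epsOf θ - 1)))) := by ring
  · -- Gaussian window
    have hX : 0 < β ^ (2 * epsOf θ - 1) := Real.rpow_pos_of_pos hβ0 _
    -- first term
    have t1 : (D : ℝ) / 2 * (β ^ θ) ^ 2 / β ≤ β ^ (2 * epsOf θ - 1) / 4 := by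
      have h := h₂ β hβ₂
      have e : (β ^ θ) ^ 2 / β = β ^ (2 * θ - 1) := by
        rw [← Real.rpow_natCast, ← Real.rpow_mul hβ0.le, Real.rpow_sub hβ0, Real.rpow_one]; norm_num; ring_nf
      calc (D : ℝ) / 2 * (β ^ θ) ^ 2 / β = (2 * (D : ℝ) * β ^ (2 * θ - 1)) / 4 := by rw [← e]; ring
        _ ≤ β ^ (2 * epsOf θ - 1) / 4 := by linarith
    -- second term
    have hPle : 12 * (H : ℝ) ^ 2 + 2 * H + 1 ≤ 3 * (2 * (H : ℝ) + 3) ^ 2 := by nlinarith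
    have emE : Real.sqrt D * ((12 * (H : ℝ) ^ 2 + 2 * H + 1) * β ^ θ) / Real.sqrt β =
        Real.sqrt D * (12 * (H : ℝ) ^ 2 + 2 * H + 1) * β ^ (θ - 1 / 2) := by
      rw [hsq, Real.rpow_sub hβ0]
      ring
    have hmE0 : 0 ≤ Real.sqrt D * (12 * (H : ℝ) ^ 2 + 2 * H + 1) * β ^ (θ - 1 / 2) := by positivity
    have t2a : (Real.sqrt D * (12 * (H : ℝ) ^ 2 + 2 * H + 1) * β ^ (θ - 1 / 2)) ^ 3 ≤
        (Real.sqrt D) ^ 3 * 27 * (2 * (H : ℝ) + 3) ^ 6 * β ^ (3 * θ - 3 / 2) := by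
      have hle : Real.sqrt D * (12 * (H : ℝ) ^ 2 + 2 * H + 1) * β ^ (θ - 1 / 2) ≤
          Real.sqrt D * (3 * (2 * (H : ℝ) + 3) ^ 2) * β ^ (θ - 1 / 2) :=
        mul_le_mul_of_nonneg_right (mul_le_mul_of_nonneg_left hPle (Real.sqrt_nonneg _)) (Real.rpow_nonneg hβ0.le _)
      have h3 : (β ^ (θ - 1 / 2)) ^ 3 = β ^ (3 * θ - 3 / 2) := by
        rw [← Real.rpow_natCast, ← Real.rpow_mul hβ0.le]; congr 1; push_cast; ring
      calc (Real.sqrt D * (12 * (H : ℝ) ^ 2 + 2 * H + 1) * β ^ (θ - 1 / 2)) ^ 3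
          ≤ (Real.sqrt D * (3 * (2 * (H : ℝ) + 3) ^ 2) * β ^ (θ - 1 / 2)) ^ 3 := pow_le_pow_left₀ hmE0 hle 3
        _ = (Real.sqrt D) ^ 3 * 27 * (2 * (H : ℝ) + 3) ^ 6 * β ^ (3 * θ - 3 / 2) := by rw [← h3]; ring
    have t2 : 190 * (Real.sqrt D * ((12 * (H : ℝ) ^ 2 + 2 * H + 1) * β ^ θ) / Real.sqrt β) ^ 3 ≤ β ^ (2 * epsOf θ - 1) / 2 := by
      rw [emE]
      have h := h₃ β hβ₃
      calc 190 * (Real.sqrt D * (12 * (H : ℝ) ^ 2 + 2 * H + 1) * β ^ (θ - 1 / 2)) ^ 3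
          ≤ 190 * ((Real.sqrt D) ^ 3 * 27 * (2 * (H : ℝ) + 3) ^ 6 * β ^ (3 * θ - 3 / 2)) := by linarith [t2a]
        _ = (2 * (190 * (Real.sqrt D) ^ 3 * 27) * (2 * (H : ℝ) + 3) ^ 6 * β ^ (3 * θ - 3 / 2)) / 2 := by ring
        _ ≤ β ^ (2 * epsOf θ - 1) / 2 := by linarith
    linarith
  · -- bad mass
    have h := h₄ β hβ₄
    rw [Real.rpow_zero] at h
    have h2θ : 2 ≤ β ^ θ := by have := h₇ β hβ₇; rw [Real.rpow_zero, mul_one] at this; exact this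
    have hexp : Real.exp (-(β ^ θ) ^ 2 / 2) ≤ Real.exp (-(β ^ θ)) := by
      refine Real.exp_le_exp.2 ?_
      have : β ^ θ ≤ (β ^ θ) ^ 2 / 2 := by nlinarith
      linarith
    have hH3 : (2 * (H : ℝ) + 1) ^ 4 ≤ (2 * (H : ℝ) + 3) ^ 4 := pow_le_pow_left₀ (by positivity) (by linarith) 4
    have hD0 : (0 : ℝ) ≤ 240 * (D : ℝ) := by positivity
    calc 240 * (D : ℝ) * (2 * (H : ℝ) + 1) ^ 4 * Real.exp (-(β ^ θ) ^ 2 / 2)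
        ≤ 240 * (D : ℝ) * (2 * (H : ℝ) + 3) ^ 4 * Real.exp (-(β ^ θ)) :=
          mul_le_mul (mul_le_mul_of_nonneg_left hH3 hD0) hexp (Real.exp_pos _).le (by positivity)
      _ = (2 * (240 * (D : ℝ)) * (2 * (H : ℝ) + 3) ^ 4 * Real.exp (-(β ^ θ))) / 2 := by ring
      _ ≤ 1 / 2 := by linarith
      _ < 1 := by norm_num
  · -- `K H⁶/β ≤ 1`
    have h := h₅ β hβ₅
    rw [Real.rpow_zero] at h
    have hH6 : (H : ℝ) ^ 6 ≤ 64 * β ^ (6 * θ) := by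
      have := pow_le_pow_left₀ (by positivity) hHle 6
      have e : (2 * β ^ θ) ^ 6 = 64 * β ^ (6 * θ) := by
        rw [mul_pow, ← Real.rpow_natCast (β ^ θ), ← Real.rpow_mul hβ0.le]; norm_num; ring_nf
      linarith [e ▸ this]
    have e2 : β ^ (6 * θ - 1) = β ^ (6 * θ) / β := by rw [Real.rpow_sub hβ0, Real.rpow_one]
    rw [e2] at h
    by_cases hK : 0 ≤ K
    · calc K * (H : ℝ) ^ 6 / β ≤ K * (64 * β ^ (6 * θ)) / β := by gcongr
        _ = 64 * K * (β ^ (6 * θ) / β) := by ring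
        _ ≤ 1 := h
    · have : K * (H : ℝ) ^ 6 / β ≤ 0 := by
        apply div_nonpos_of_nonpos_of_nonneg _ hβ0.le
        exact mul_nonpos_of_nonpos_of_nonneg (le_of_not_ge hK) (by positivity)
      linarith
  · -- conditioning error
    have h := h₆ β hβ₆
    rw [Real.rpow_neg hβ0.le, Real.rpow_one, inv_eq_one_div] at h
    have e : β ^ 2 * (24 * ((2 : ℕ) : ℝ) ^ 2 * Real.exp (-(β ^ epsOf θ))) =
        24 * ((2 : ℕ) : ℝ) ^ 2 * β ^ (2 : ℝ) * Real.exp (-(β ^ epsOf θ)) := by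
      rw [Real.rpow_two]; ring
    rw [e]; exact h


end Summit.QuantumFields.YangMills.Theorems.AllWindowsColdBoxBoxMidLine

end
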